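import Mathlib
import Summits.AtomisticToContinuum.Crystallization.Theses.EnergyDerivativeOrder
import Literature.Geometry.DiscreteGeometry.KissingRigidity
import Summits.AtomisticToContinuum.Crystallization.Theorems.EnergyDerivativeOrderLimitTransferHcpShells

/-!
# Birth skeleton — piece P1 `TwoRadiusShellPatterns` of the split of C2 `SpectralRigidityHcp`
# (route EnergyDerivativeOrder, stmt-AtomisticToContinuum-12278; crux-strategist 2026-08-17)

Line: the two ratio regimes are two different classifications.
* `stub_ideal` (`h² = ⅔a²`, one radius): twelve points of the sphere `S²(a)` with pairwise
  cosines in the finite menu `{1/2, 0, -1/3, -1/2, -5/6, -1}` (= squared distances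
  `{1,2,8/3,3,11/3,4}·a²`, the ideal hcp spectrum below `2a`) are the cuboctahedral or the
  anticuboctahedral code — an EXACTLY GAPPED kissing configuration (non-contacts `≥ √2 a > 1.26a`,
  so `(2/a)·T ∈ 𝒱` of Hales 2012): identify the contact graph (degree four, eight triangles) by a
  finite angular census, then Hales's Lemma 10 as PROVED in `KissingRigidity.lean`
  (`isArrangedIn_fcc/hcp_of_contactGraph_iso`, realizations `fcc_rigid`/`hcp_rigid`).
* `stub_nonideal` (`h² ≠ ⅔a²`, two radii `a ≠ a'`): the menu is
  `a²·{1, 1/3+r, 3, 4, 4/3+r, 7/3+r, 13/3+r, 4r, 1+4r, 3+4r}`; the radius-`a` points must be the six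
  vertices of the in-plane hexagon and the radius-`a'` points two hole triples of the same type
  on opposite sides (the `LayerShells.IsTwelveConfig.eq_layerShell` argument with two radii); a
  cuboctahedral placement of the triples would realise `a²/3 + 4h² ∉ spec²` and is excluded by
  the hypothesis itself (so the second disjunct is vacuous there, but keeping it is harmless).
`TwoRadiusShellPatterns_of` is the case split on the ratio.  The piece is restated verbatim
(`def TwoRadiusShellPatterns`) until the route split installs `EnergyDerivativeOrder.TwoRadiusShellPatterns`.
Refuter evidence on stmt-12278 (exact enumerations: ideal 10 labelled solutions = 8 anticubocta +
2 cubocta; two-radius search at 809 ratios: only the hcp shell) is the census both stubs formalise.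
-/

noncomputable section

namespace Summit.AtomisticToContinuum.Crystallization.Cruxes.SpectralRigidityHcp.TwoRadiusShellPatternsBirth

open Literature.MathematicalPhysics.StatisticalMechanics

/-- Piece P1 of the C2 split (verbatim; becomes `EnergyDerivativeOrder.TwoRadiusShellPatterns`). -/
def TwoRadiusShellPatterns : Prop :=
  ∀ a h : ℝ, 0 < a → |h / a - Real.sqrt (2 / 3)| ≤ 1 / 400 → ∀ T : Set (EuclideanSpace ℝ (Fin 3)), T.ncard = 12 → (∀ t ∈ T, dist 0 t = a ∨ dist 0 t = Real.sqrt (a ^ 2 / 3 + h ^ 2)) → (∀ t ∈ T, ∀ t' ∈ T, t ≠ t' → ∃ p ∈ hcpStacking a h, ∃ q ∈ hcpStacking a h, dist t t' = dist p q) → ∃ A : EuclideanSpace ℝ (Fin 3) →ₗᵢ[ℝ] EuclideanSpace ℝ (Fin 3), T = A '' {p ∈ hcpStacking a h | p ≠ 0 ∧ dist 0 p ≤ 6 / 5 * a} ∨ T = A '' {p ∈ fccStacking a h | p ≠ 0 ∧ dist 0 p ≤ 6 / 5 * a}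

/-- STUB (ideal ratio, one radius; L): the finite spherical-code classification with cosine menu
`{1/2, 0, -1/3, -1/2, -5/6, -1}` — cuboctahedron or anticuboctahedron. -/
theorem stub_ideal :
    ∀ a h : ℝ, 0 < a → |h / a - Real.sqrt (2 / 3)| ≤ 1 / 400 → h ^ 2 = 2 / 3 * a ^ 2 → ∀ T : Set (EuclideanSpace ℝ (Fin 3)), T.ncard = 12 → (∀ t ∈ T, dist 0 t = a ∨ dist 0 t = Real.sqrt (a ^ 2 / 3 + h ^ 2)) → (∀ t ∈ T, ∀ t' ∈ T, t ≠ t' → ∃ p ∈ hcpStacking a h, ∃ q ∈ hcpStacking a h, dist t t' = dist p q) → ∃ A : EuclideanSpace ℝ (Fin 3) →ₗᵢ[ℝ] EuclideanSpace ℝ (Fin 3), T = A '' {p ∈ hcpStacking a h | p ≠ 0 ∧ dist 0 p ≤ 6 / 5 * a} ∨ T = A '' {p ∈ fccStacking a h | p ≠ 0 ∧ dist 0 p ≤ 6 / 5 * a} := by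
  sorry

/-- STUB (non-ideal ratio in the window, two radii `a ≠ a' = √(a²/3 + h²)`; L): hexagon forced at
radius `a`, hole triples of one type at radius `a'` on both sides — the relaxed hcp shell (the
cuboctahedral disjunct is kept for uniformity; it is excluded by the spectrum itself). -/
theorem stub_nonideal :
    ∀ a h : ℝ, 0 < a → |h / a - Real.sqrt (2 / 3)| ≤ 1 / 400 → h ^ 2 ≠ 2 / 3 * a ^ 2 → ∀ T : Set (EuclideanSpace ℝ (Fin 3)), T.ncard = 12 → (∀ t ∈ T, dist 0 t = a ∨ dist 0 t = Real.sqrt (a ^ 2 / 3 + h ^ 2)) → (∀ t ∈ T, ∀ t' ∈ T, t ≠ t' → ∃ p ∈ hcpStacking a h, ∃ q ∈ hcpStacking a h, dist t t' = dist p q) → ∃ A : EuclideanSpace ℝ (Fin 3) →ₗᵢ[ℝ] EuclideanSpace ℝ (Fin 3), T = A '' {p ∈ hcpStacking a h | p ≠ 0 ∧ dist 0 p ≤ 6 / 5 * a} ∨ T = A '' {p ∈ fccStacking a h | p ≠ 0 ∧ dist 0 p ≤ 6 / 5 * a} := by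
  sorry

/-- **Composition**: case split on the ratio. -/
theorem TwoRadiusShellPatterns_of
    (hI : ∀ a h : ℝ, 0 < a → |h / a - Real.sqrt (2 / 3)| ≤ 1 / 400 → h ^ 2 = 2 / 3 * a ^ 2 → ∀ T : Set (EuclideanSpace ℝ (Fin 3)), T.ncard = 12 → (∀ t ∈ T, dist 0 t = a ∨ dist 0 t = Real.sqrt (a ^ 2 / 3 + h ^ 2)) → (∀ t ∈ T, ∀ t' ∈ T, t ≠ t' → ∃ p ∈ hcpStacking a h, ∃ q ∈ hcpStacking a h, dist t t' = dist p q) → ∃ A : EuclideanSpace ℝ (Fin 3) →ₗᵢ[ℝ] EuclideanSpace ℝ (Fin 3), T = A '' {p ∈ hcpStacking a h | p ≠ 0 ∧ dist 0 p ≤ 6 / 5 * a} ∨ T = A '' {p ∈ fccStacking a h | p ≠ 0 ∧ dist 0 p ≤ 6 / 5 * a})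
    (hN : ∀ a h : ℝ, 0 < a → |h / a - Real.sqrt (2 / 3)| ≤ 1 / 400 → h ^ 2 ≠ 2 / 3 * a ^ 2 → ∀ T : Set (EuclideanSpace ℝ (Fin 3)), T.ncard = 12 → (∀ t ∈ T, dist 0 t = a ∨ dist 0 t = Real.sqrt (a ^ 2 / 3 + h ^ 2)) → (∀ t ∈ T, ∀ t' ∈ T, t ≠ t' → ∃ p ∈ hcpStacking a h, ∃ q ∈ hcpStacking a h, dist t t' = dist p q) → ∃ A : EuclideanSpace ℝ (Fin 3) →ₗᵢ[ℝ] EuclideanSpace ℝ (Fin 3), T = A '' {p ∈ hcpStacking a h | p ≠ 0 ∧ dist 0 p ≤ 6 / 5 * a} ∨ T = A '' {p ∈ fccStacking a h | p ≠ 0 ∧ dist 0 p ≤ 6 / 5 * a}) :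
    TwoRadiusShellPatterns := by
  intro a h ha hwin T hT hrad hdist
  by_cases hr : h ^ 2 = 2 / 3 * a ^ 2
  · exact hI a h ha hwin hr T hT hrad hdist
  · exact hN a h ha hwin hr T hT hrad hdist

end Summit.AtomisticToContinuum.Crystallization.Cruxes.SpectralRigidityHcp.TwoRadiusShellPatternsBirth

end
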